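import Summits.QuantumFields.BalabanUV.T4Continuum.Support.RegionGramTwoLevelMonotone
import Summits.QuantumFields.BalabanUV.T4Continuum.Support.DirichletCornerRegularity
import Summits.QuantumFields.BalabanUV.T4Continuum.Support.RegionGaugeColumnsRegion
import Summits.QuantumFields.BalabanUV.T4Continuum.Support.RegionGaugeBoxHole

/-!
# T⁴ programme, spine node NE2 (U1a), sub-row Δ1 «NE2⁰-Dirichlet» — KING's COMPRESSED INJECTED LAW OF THE FAITHFUL `Δ_a(Ω₀)` ON A
# LOCALLY MONOTONE UNION OF UNIT BLOCKS / ON THE COMPLEMENT OF A BOX: the resolvent-split cut with (K), (B), (Bᵗ) and the budget algebra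
# DISCHARGED — displayed: the local leaf (L) and ONE scalar number, the CORNER MASS of the region Dirichlet solution (+ W1 off the box class)

NE2 formalisation swarm `b2b-balaban-t4-ne2-formalise-*`, LEAF PROVER 09 (gen 10), junction of this seat's bricks (journal `HOME/CLAIMS.log`
2026-08-21 l.23790 / l.24182 / l.24306; owner R42 GO + (c) «level-dependent constants with a displayed growth rate»):
`RegionGramTwoLevelMonotone.hK_monotone` (p243206: leaf (K) on every locally monotone union at `(√L)⁻¹`) and `DirichletCornerRegularity`
(p243392: `hdiag_add_hmixed_le_corner`, `budget_le_of_cornerMass_lev` — the scalar budgets from a displayed corner-mass growth), plugged into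
leaf-05-g9's `RegionGaugeColumnsRegion.hB_of_budget` (p24xxxx: leaf (B) on ANY union modulo the two scalar budgets `hΛ`, `hΛm`) and leaf-06-g7's
`RegionGaugeColumnsTraceRegion.hinjK_of_local_of_coercive_of_budget` (p241856 = the owner's O15-f region reduction with (Bᵗ) ⟸ (B) + `hΛ`).

 * §1 the MIXED budget from the corner mass: **`hmixed_solExt_le_corner`** `Hmixed n (solExt f) ≤ LamH d a′·‖f‖² + 2(d−1)n⁴·cornerMass Ω (solExt f)`
   on ANY union (file 1's `Hdiag + Hmixed ≤ Σ_Ω|Δz|² + …`, `Hdiag ≥ 0`, gan24's `sum_normSq_LapS_solExt_le`); along the tower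
   **`hmixed_le_of_cornerMass_lev`** = leaf-05-g9's `hΛm` VERBATIM with `Λm k := LamH d a′ + 2(d−1)τ k`;
 * §2 **`hB_of_cornerMass`** — leaf (B) on ANY union from a displayed corner-mass growth `hτ` and its rate
   `√(CgaugeRsq d L a′ (Lam d a′ + 2(d−1)τ_k) (LamH d a′ + 2(d−1)τ_k))·(√n_k)⁻¹ ≤ CB·θ^k`;
 * §3 **`hinjK_of_local_of_cornerMass_monotone`** — on a LOCALLY MONOTONE union (`2 ≤ L`, `1 ≤ d`, `0 < a′`): given W1 as a level-uniform
   coercivity constant `γ`, the corner-mass growth `hτ` with its two rates (`hrate` for (Bᵗ), `hrateB` for (B)) and the local leaf (L) at rate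
   `θ ≥ (√L)⁻¹`: `‖G_{k+1}·JpR k − JpR k·G_k‖ ≤ C1reg d a′ γ Cl CB (CB + (1 − L⁻¹)CH) CgramM · θ^k`; `…_slice` with W1 as ONE slice constant;
 * §4 THE COMPLEMENT OF A BOX OF BLOCKS (`T ∖ boxBlocks M lo len`, `1 ≤ len_ν`, `len_ν + 2 ≤ M_ν`, `0 < a`): **`isCoordBox_boxBlocks`**
   (this lineage's `boxBlocks` IS a coordinate box), hence locally monotone complement, AND W1 there is THIS LINEAGE's theorem
   `RegionGaugeBoxHole.sliceCoercive_lev_boxHole` (gen 9, p239887) ⟹ **THE END `hinjK_boxHole_of_local_of_cornerMass`**: King's compressed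
   injected law of the faithful `Δ_a(Ω₀)` on the torus minus a box DISPLAYS ONLY the local leaf (L) and the corner-mass growth `τ_k` of the
   scalar region Dirichlet solution with its two rates — W1, (K), (B), (Bᵗ) are theorems.
The honest wall, typed: both rates decay geometrically iff `τ_{n_k}` grows strictly slower than `n_k` (trivially `≤ γ′⁻¹n²`; a Rellich-type
flux identity gives `≍ n`, the borderline; expected truth `≍ n^{2/3}` at a right-angled re-entrant edge — leaf-07-g10 `t4/T4-EST-NE2-D1-REENTRANT.md`);
and (L) on re-entrant regions is the vector-layer corner problem (leaf-07-g10: «route dead, leaf alive»).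

HONEST FRAMING (T4-DAG p. 1).  Bookkeeping over landed modules ([folklore]); model level (`U = 1`, ONE region, ONE averaging scale, finite
torus, operator norm); (L), the corner-mass growth and its rates DISPLAYED — nothing about them is proved here; `hinjK` ∕ W3 off boxes OPEN;
Δ1 NOT closed; NE2 (U1a) NOT proved; spine PROVED 0/9 unchanged; NOT [B9] (3.16)/(3.23)–(3.27)/(3.42)/(3.48) as printed; NOT infinite volume,
NOT a mass gap, NOT the Clay problem.  HONEST DEPENDENCY: continuum YM on T⁴ ⇐ BetaPertH ∧ nine spine estimates (0/9 proved); BetaPertH ⇐ (D1)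
∧ (D4) ∧ CAP+tail; G-an2-4 gates asym, D1 and NE2/3/4.  No `sorry`.
-/

noncomputable section

open scoped BigOperators ComplexConjugate Matrix Matrix.Norms.L2Operator
open Finset

namespace Summit.QuantumFields.BalabanUV.T4Continuum.RegionGaugeResolventTowerMonotone

open Literature.MathematicalPhysics.QuantumFieldTheory.Balaban1983to89.B5Prop11Plancherel (Tor fine)
open Literature.MathematicalPhysics.QuantumFieldTheory.Balaban1983to89.B5Prop11Lower (nsq nsq_nonneg)
open Literature.MathematicalPhysics.QuantumFieldTheory.Balaban1983to89.B5Action121 (LapS)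
open Literature.MathematicalPhysics.QuantumFieldTheory.Balaban1983to89.B5G183RateUnitTower (lev)
open Summit.QuantumFields.BalabanUV.T4Continuum
open Summit.QuantumFields.BalabanUV.T4Continuum.ScalarAveragedPropagator (gammaPs gammaPs_pos)
open Summit.QuantumFields.BalabanUV.T4Continuum.ScalarAveragedCompression (sigma0)
open Summit.QuantumFields.BalabanUV.T4Continuum.SubtypeCompression (Coercive)
open Summit.QuantumFields.BalabanUV.T4Continuum.RegionScalarCompression (QOm GOm KcompR)
open Summit.QuantumFields.BalabanUV.T4Continuum.RegionGaugeSlice (SliceCoercive)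
open Summit.QuantumFields.BalabanUV.T4Continuum.RegionGaugeFixedVector (starReg curlR gradR avgR regionDeltaA)
open Summit.QuantumFields.BalabanUV.T4Continuum.RegionGaugeResolventSplit (regionBh regionDeltaLoc)
open Summit.QuantumFields.BalabanUV.T4Continuum.DirichletSubregionTowerOf (pidx JpR)
open Summit.QuantumFields.BalabanUV.T4Continuum.DirichletStarVectorTower (starP gamStar gamStar_pos coercive_regionDeltaA_of_slice)
open Summit.QuantumFields.BalabanUV.T4Continuum.RegionGaugeResolventTowerRegion (C1reg)
open Summit.QuantumFields.BalabanUV.T4Continuum.RegionGaugeColumnsTraceRegion (hinjK_of_local_of_coercive_of_budget)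
open Summit.QuantumFields.BalabanUV.T4Continuum.RegionGaugeColumnsTwoLevel (LamH)
open Summit.QuantumFields.BalabanUV.T4Continuum.RegionGaugeColumnsRegion (CgaugeRsq hB_of_budget)
open Summit.QuantumFields.BalabanUV.T4Continuum.RegionGramTwoLevelMonotone (hK_monotone)
open Summit.QuantumFields.BalabanUV.T4Continuum.DirichletCornerRegularity (cornerMass cornerMass_nonneg hdiag_add_hmixed_le_corner
  budget_le_of_cornerMass_lev Lam_add_nonneg)
open Summit.QuantumFields.BalabanUV.T4Continuum.DirichletBesovTwoLevel (besovConst)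
open Summit.QuantumFields.BalabanUV.T4Continuum.DirichletMonotoneCutoff (LocallyMonotone)
open Summit.QuantumFields.BalabanUV.T4Continuum.DirichletMonotoneExamples (locallyMonotone_compl_of_isCoordBox)
open Summit.QuantumFields.BalabanUV.T4Continuum.RegionGaugeHoled (holedConst holedConst_pos)
open Summit.QuantumFields.BalabanUV.T4Continuum.RegionBoxCollarFold (cblkB)
open Summit.QuantumFields.BalabanUV.T4Continuum.RegionBoxCollarLift (KIn mem_KIn)
open Summit.QuantumFields.BalabanUV.T4Continuum.RegionGaugeBoxHole (boxBlocks sliceCoercive_lev_boxHole)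
open Summit.QuantumFields.BalabanUV.Beta.GAN24.DirichletBoxRegularity (SuppIn Hdiag Hmixed hdiag_nonneg)
open Summit.QuantumFields.BalabanUV.Beta.GAN24.DirichletBoxCompression (solExt solExt_apply_of_not sum_normSq_LapS_solExt_le)
open Summit.QuantumFields.BalabanUV.Beta.GAN24.DirichletBoxTrace (blockReg)
open Summit.QuantumFields.BalabanUV.Beta.GAN24.DirichletBoxTwoLevel (IsCoordBox Lam)

variable {d : ℕ}

/-! ## §1 The mixed budget from the corner mass -/

section Mixed

variable (n : ℕ) [NeZero n] (M : Fin d → ℕ) [hM : ∀ μ, NeZero (M μ)] (S : Tor M → Prop) [DecidablePred S] {a' : ℝ}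

/-- **THE MIXED HESSIAN OF A ZERO-EXTENDED REGION DIRICHLET SOLUTION ON ANY UNION OF UNIT BLOCKS**: for any decidable spelling `p` of
`Ω = blockReg n S`, `Hmixed n (solExt_p f) ≤ LamH d a′·‖f‖² + 2(d−1)·n⁴·cornerMass Ω (solExt_p f)` (`LamH = 2(1 + (a′γ′⁻¹)²)`). [folklore] -/
theorem hmixed_solExt_le_corner (ha' : 0 < a') (p : Tor (fine n M) → Prop) [DecidablePred p] (hp : ∀ x, p x ↔ blockReg n M S x)
    (f : {x // p x} → ℂ) :
    Hmixed (n : ℂ) (solExt n M a' p f)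
      ≤ LamH d a' * nsq f + 2 * ((d : ℝ) - 1) * (n : ℝ) ^ 4 * cornerMass (univ.filter (blockReg n M S)) (solExt n M a' p f) := by
  set u := solExt n M a' p f with hu
  have hsupp : SuppIn (fine n M) (univ.filter (blockReg n M S)) u := by
    intro x hx
    rw [Finset.mem_filter] at hx
    exact solExt_apply_of_not n M a' p f (fun h => hx ⟨Finset.mem_univ _, (hp x).mp h⟩)
  have h1 := hdiag_add_hmixed_le_corner hsupp (n : ℂ)
  have hn4 : (‖(n : ℂ)‖ ^ 2) ^ 2 = (n : ℝ) ^ 4 := by rw [Complex.norm_natCast]; ring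
  rw [hn4] at h1
  have h2 : ∑ x ∈ univ.filter (blockReg n M S), ‖(LapS (fine n M) (n : ℂ) *ᵥ u) x‖ ^ 2
      = ∑ a : {x // p x}, ‖(LapS (fine n M) (n : ℂ) *ᵥ u) a‖ ^ 2 :=
    Finset.sum_subtype _ (fun x => by simp [hp x]) (fun x => ‖(LapS (fine n M) (n : ℂ) *ᵥ u) x‖ ^ 2)
  have h3 := sum_normSq_LapS_solExt_le n M a' p ha' f
  rw [← hu] at h3
  have h4 := hdiag_nonneg (n : ℂ) (univ.filter (blockReg n M S)) u
  unfold LamH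
  linarith

end Mixed

/-! ## §2 Leaf (B) on any union from the corner mass -/

section Tower

variable (L : ℕ) [NeZero L] (M : Fin d → ℕ) [hM : ∀ μ, NeZero (M μ)] (S : Tor M → Prop) [DecidablePred S] (a a' : ℝ)

/-- the mixed budget along the tower: a displayed corner-mass growth `hτ` yields leaf-05-g9's `hΛm` VERBATIM with `Λm k := LamH d a′ + 2(d−1)τ k`
(`1 ≤ d`). [folklore] -/
theorem hmixed_le_of_cornerMass_lev (hd : 1 ≤ d) (ha' : 0 < a') {τ : ℕ → ℝ}
    (hτ : ∀ (k : ℕ) (f : {x // blockReg (lev L k) M S x} → ℂ),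
      ((lev L k : ℕ) : ℝ) ^ 4 * cornerMass (univ.filter (blockReg (lev L k) M S)) (solExt (lev L k) M a' (blockReg (lev L k) M S) f)
        ≤ τ k * nsq f)
    (k : ℕ) (f : {x // blockReg (lev L k) M S x} → ℂ) :
    Hmixed ((lev L k : ℕ) : ℂ) (solExt (lev L k) M a' (blockReg (lev L k) M S) f) ≤ (LamH d a' + 2 * ((d : ℝ) - 1) * τ k) * nsq f := by
  have h := hmixed_solExt_le_corner (lev L k) M S ha' (blockReg (lev L k) M S) (fun _ => Iff.rfl) f
  have hd' : 0 ≤ 2 * ((d : ℝ) - 1) := by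
    have : (1 : ℝ) ≤ d := by exact_mod_cast hd
    linarith
  have := mul_le_mul_of_nonneg_left (hτ k f) hd'
  nlinarith

/-- `0 ≤ LamH d a′ + 2(d−1)τ k` for `1 ≤ d`, `0 ≤ τ k`. [folklore] -/
theorem LamH_add_nonneg (hd : 1 ≤ d) {τ : ℕ → ℝ} (hτ0 : ∀ k, 0 ≤ τ k) (k : ℕ) : 0 ≤ LamH d a' + 2 * ((d : ℝ) - 1) * τ k := by
  have hΛ : 0 ≤ LamH d a' := by unfold LamH; positivity
  have hd' : (1 : ℝ) ≤ d := by exact_mod_cast hd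
  have := hτ0 k
  nlinarith

/-- **LEAF (B) ON ANY UNION OF UNIT BLOCKS FROM THE CORNER MASS** (`1 ≤ d`, `0 < a′`): a displayed corner-mass growth `hτ` with the rate
`√(CgaugeRsq d L a′ (Lam d a′ + 2(d−1)τ_k) (LamH d a′ + 2(d−1)τ_k))·(√n_k)⁻¹ ≤ CB·θ^k` gives the owner's `hB` VERBATIM (leaf-05-g9's `hB_of_budget`
with both budgets from file 1). [folklore] -/
theorem hB_of_cornerMass (hd : 1 ≤ d) (ha' : 0 < a') {τ : ℕ → ℝ} (hτ0 : ∀ k, 0 ≤ τ k)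
    (hτ : ∀ (k : ℕ) (f : {x // blockReg (lev L k) M S x} → ℂ),
      ((lev L k : ℕ) : ℝ) ^ 4 * cornerMass (univ.filter (blockReg (lev L k) M S)) (solExt (lev L k) M a' (blockReg (lev L k) M S) f)
        ≤ τ k * nsq f)
    {θ CB : ℝ}
    (hrateB : ∀ k, Real.sqrt (CgaugeRsq d L a' (Lam d a' + 2 * ((d : ℝ) - 1) * τ k) (LamH d a' + 2 * ((d : ℝ) - 1) * τ k))
      * (Real.sqrt ((lev L k : ℕ) : ℝ))⁻¹ ≤ CB * θ ^ k) (k : ℕ) :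
    ‖regionBh (lev L (k + 1)) M a' S - JpR L M (starP L M S) k * regionBh (lev L k) M a' S‖ ≤ CB * θ ^ k :=
  hB_of_budget L M a' S ha' (Λ := fun k => Lam d a' + 2 * ((d : ℝ) - 1) * τ k) (Λm := fun k => LamH d a' + 2 * ((d : ℝ) - 1) * τ k)
    (fun k => Lam_add_nonneg hd hτ0 k) (fun k => LamH_add_nonneg a' hd hτ0 k)
    (budget_le_of_cornerMass_lev L M S hd ha' hτ) (hmixed_le_of_cornerMass_lev L M S a' hd ha' hτ) hrateB k

/-! ## §3 The cut on a locally monotone union: displayed W1, (L), the corner mass -/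

omit hM [DecidablePred S] in
/-- `2 ≤ L` gives `1 ≤ L`. [folklore] -/
theorem one_le_of_two_le {L : ℕ} (hL : 2 ≤ L) : 1 ≤ L := le_trans (by norm_num) hL

/-- **KING's COMPRESSED INJECTED LAW OF `Δ_a(Ω₀)` ON A LOCALLY MONOTONE UNION — THE CUT WITH (K), (B), (Bᵗ) AND THE BUDGET ALGEBRA
DISCHARGED**: displayed are W1 (`γ`), the corner-mass growth `τ` with its two rates (`hrate` feeds (Bᵗ), `hrateB` feeds (B)) and the local
leaf (L); `θ ≥ (√L)⁻¹`. [folklore] -/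
theorem hinjK_of_local_of_cornerMass_monotone (hS : LocallyMonotone M S) (hL : 2 ≤ L) (hd : 1 ≤ d) (ha' : 0 < a')
    {γ : ℝ} (hγ : 0 < γ) (hco : ∀ k, Coercive (regionDeltaA (lev L k) M a a' S) γ)
    {τ : ℕ → ℝ} (hτ0 : ∀ k, 0 ≤ τ k)
    (hτ : ∀ (k : ℕ) (f : {x // blockReg (lev L k) M S x} → ℂ),
      ((lev L k : ℕ) : ℝ) ^ 4 * cornerMass (univ.filter (blockReg (lev L k) M S)) (solExt (lev L k) M a' (blockReg (lev L k) M S) f)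
        ≤ τ k * nsq f)
    {θ CH CB Cl : ℝ} (hθ : (Real.sqrt (L : ℝ))⁻¹ ≤ θ) (hCB : 0 ≤ CB)
    (hrate : ∀ k, Real.sqrt (2 * (Lam d a' + 2 * ((d : ℝ) - 1) * τ k) / ((lev L k : ℕ) : ℝ)) ≤ CH * θ ^ k)
    (hrateB : ∀ k, Real.sqrt (CgaugeRsq d L a' (Lam d a' + 2 * ((d : ℝ) - 1) * τ k) (LamH d a' + 2 * ((d : ℝ) - 1) * τ k))
      * (Real.sqrt ((lev L k : ℕ) : ℝ))⁻¹ ≤ CB * θ ^ k)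
    (hloc : ∀ k, ‖(regionDeltaLoc (lev L (k + 1)) M a S)⁻¹ * JpR L M (starP L M S) k
        - JpR L M (starP L M S) k * (regionDeltaLoc (lev L k) M a S)⁻¹‖ ≤ Cl * θ ^ k) (k : ℕ) :
    ‖(regionDeltaA (lev L (k + 1)) M a a' S)⁻¹ * JpR L M (starP L M S) k
        - JpR L M (starP L M S) k * (regionDeltaA (lev L k) M a a' S)⁻¹‖
      ≤ C1reg d a' γ Cl CB (CB + (1 - (L : ℝ)⁻¹) * CH)
          (((sigma0 d a') ^ 2)⁻¹ * ((sigma0 d a') ^ 2)⁻¹ * (2 * (gammaPs d a')⁻¹ * (besovConst d a' 6 48 * Real.sqrt (L : ℝ))))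
        * θ ^ k := by
  have hθ0 : 0 ≤ θ := le_trans (inv_nonneg.mpr (Real.sqrt_nonneg _)) hθ
  exact hinjK_of_local_of_coercive_of_budget L M S a' (one_le_of_two_le hL) a ha' hγ hco
    (Λ := fun k => Lam d a' + 2 * ((d : ℝ) - 1) * τ k) (fun k => Lam_add_nonneg hd hτ0 k)
    (budget_le_of_cornerMass_lev L M S hd ha' hτ) hθ0 hCB hrate hloc (hB_of_cornerMass L M S a' hd ha' hτ0 hτ hrateB)
    (hK_monotone L M a' S hS hL ha' hθ) k

/-- **THE SAME WITH W1 AS ONE SLICE CONSTANT** (`SliceCoercive … (a·n_k^d) c` at every level, `0 < c`): `γ = gamStar d a′ c`. [folklore] -/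
theorem hinjK_of_local_of_cornerMass_monotone_slice (hS : LocallyMonotone M S) (hL : 2 ≤ L) (hd : 1 ≤ d) (ha' : 0 < a')
    {c : ℝ} (hc : 0 < c)
    (hS1 : ∀ k, SliceCoercive (curlR (lev L k) M S) (gradR (lev L k) M S) (GOm (lev L k) M a' S) (QOm (lev L k) M S)
      (avgR (lev L k) M S) (a * ((lev L k : ℕ) : ℝ) ^ d) c)
    {τ : ℕ → ℝ} (hτ0 : ∀ k, 0 ≤ τ k)
    (hτ : ∀ (k : ℕ) (f : {x // blockReg (lev L k) M S x} → ℂ),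
      ((lev L k : ℕ) : ℝ) ^ 4 * cornerMass (univ.filter (blockReg (lev L k) M S)) (solExt (lev L k) M a' (blockReg (lev L k) M S) f)
        ≤ τ k * nsq f)
    {θ CH CB Cl : ℝ} (hθ : (Real.sqrt (L : ℝ))⁻¹ ≤ θ) (hCB : 0 ≤ CB)
    (hrate : ∀ k, Real.sqrt (2 * (Lam d a' + 2 * ((d : ℝ) - 1) * τ k) / ((lev L k : ℕ) : ℝ)) ≤ CH * θ ^ k)
    (hrateB : ∀ k, Real.sqrt (CgaugeRsq d L a' (Lam d a' + 2 * ((d : ℝ) - 1) * τ k) (LamH d a' + 2 * ((d : ℝ) - 1) * τ k))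
      * (Real.sqrt ((lev L k : ℕ) : ℝ))⁻¹ ≤ CB * θ ^ k)
    (hloc : ∀ k, ‖(regionDeltaLoc (lev L (k + 1)) M a S)⁻¹ * JpR L M (starP L M S) k
        - JpR L M (starP L M S) k * (regionDeltaLoc (lev L k) M a S)⁻¹‖ ≤ Cl * θ ^ k) (k : ℕ) :
    ‖(regionDeltaA (lev L (k + 1)) M a a' S)⁻¹ * JpR L M (starP L M S) k
        - JpR L M (starP L M S) k * (regionDeltaA (lev L k) M a a' S)⁻¹‖
      ≤ C1reg d a' (gamStar d a' c) Cl CB (CB + (1 - (L : ℝ)⁻¹) * CH)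
          (((sigma0 d a') ^ 2)⁻¹ * ((sigma0 d a') ^ 2)⁻¹ * (2 * (gammaPs d a')⁻¹ * (besovConst d a' 6 48 * Real.sqrt (L : ℝ))))
        * θ ^ k :=
  hinjK_of_local_of_cornerMass_monotone L M S a a' hS hL hd ha' (gamStar_pos (d := d) a' hc)
    (fun j => coercive_regionDeltaA_of_slice (lev L j) M a a' S ha' hc (hS1 j)) hτ0 hτ hθ hCB hrate hrateB hloc k

end Tower

/-! ## §4 The complement of a box of blocks: W1 is this lineage's theorem -/

section BoxHole

variable (L : ℕ) [NeZero L] (M : Fin d → ℕ) [hM : ∀ μ, NeZero (M μ)] (lo : Tor M) (len : Fin d → ℕ) (a a' : ℝ)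

omit [NeZero L] hM in
/-- **this lineage's box of blocks `boxBlocks M lo len` (offsets `1 ≤ k_ν ≤ len_ν` from `lo − 𝟙`) IS A COORDINATE BOX** in road P2's sense.
[folklore] -/
theorem isCoordBox_boxBlocks : IsCoordBox M (fun b => b ∈ boxBlocks M lo len) := by
  classical
  refine ⟨fun ν => (Icc 1 (len ν)).image fun j : ℕ => lo ν - 1 + ((j : ℕ) : ZMod (M ν)), fun b => ?_⟩
  simp only [boxBlocks, Finset.mem_image]
  constructor
  · rintro ⟨k, hk, rfl⟩ ν
    exact ⟨k ν, Finset.mem_Icc.mpr ((mem_KIn len).mp hk ν), rfl⟩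
  · intro h
    choose k hk hkb using h
    exact ⟨k, (mem_KIn len).mpr fun ν => Finset.mem_Icc.mp (hk ν), funext fun ν => hkb ν⟩

omit [NeZero L] in
/-- hence the complement `T ∖ boxBlocks M lo len` is LOCALLY MONOTONE. [folklore] -/
theorem locallyMonotone_boxHole : LocallyMonotone M (fun y : Tor M => y ∉ boxBlocks M lo len) :=
  locallyMonotone_compl_of_isCoordBox M (isCoordBox_boxBlocks M lo len)

/-- **THE END — KING's COMPRESSED INJECTED LAW OF THE FAITHFUL `Δ_a(Ω₀)` ON THE TORUS MINUS A BOX OF BLOCKS** (`1 ≤ len_ν`,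
`len_ν + 2 ≤ M_ν`, `2 ≤ L`, `1 ≤ d`, `0 < a`, `0 < a′`, `θ ≥ (√L)⁻¹`): W1 (this lineage's `sliceCoercive_lev_boxHole`, constant `holedConst d a a′`),
(K) (p243206), (B) and (Bᵗ) (leaf-05-g9 / leaf-06-g7 modulo budgets, budgets from the corner mass p243392) are THEOREMS; DISPLAYED remain the
local leaf (L) and the corner-mass growth `τ_k` of the scalar region Dirichlet solution with its two rates. [folklore] -/
theorem hinjK_boxHole_of_local_of_cornerMass (hlen : ∀ ν, 1 ≤ len ν) (hM2 : ∀ ν, len ν + 2 ≤ M ν) (hL : 2 ≤ L) (hd : 1 ≤ d)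
    (ha : 0 < a) (ha' : 0 < a') {τ : ℕ → ℝ} (hτ0 : ∀ k, 0 ≤ τ k)
    (hτ : ∀ (k : ℕ) (f : {x // blockReg (lev L k) M (fun y : Tor M => y ∉ boxBlocks M lo len) x} → ℂ),
      ((lev L k : ℕ) : ℝ) ^ 4 * cornerMass (univ.filter (blockReg (lev L k) M (fun y : Tor M => y ∉ boxBlocks M lo len)))
          (solExt (lev L k) M a' (blockReg (lev L k) M (fun y : Tor M => y ∉ boxBlocks M lo len)) f) ≤ τ k * nsq f)
    {θ CH CB Cl : ℝ} (hθ : (Real.sqrt (L : ℝ))⁻¹ ≤ θ) (hCB : 0 ≤ CB)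
    (hrate : ∀ k, Real.sqrt (2 * (Lam d a' + 2 * ((d : ℝ) - 1) * τ k) / ((lev L k : ℕ) : ℝ)) ≤ CH * θ ^ k)
    (hrateB : ∀ k, Real.sqrt (CgaugeRsq d L a' (Lam d a' + 2 * ((d : ℝ) - 1) * τ k) (LamH d a' + 2 * ((d : ℝ) - 1) * τ k))
      * (Real.sqrt ((lev L k : ℕ) : ℝ))⁻¹ ≤ CB * θ ^ k)
    (hloc : ∀ k, ‖(regionDeltaLoc (lev L (k + 1)) M a (fun y : Tor M => y ∉ boxBlocks M lo len))⁻¹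
          * JpR L M (starP L M (fun y : Tor M => y ∉ boxBlocks M lo len)) k
        - JpR L M (starP L M (fun y : Tor M => y ∉ boxBlocks M lo len)) k
          * (regionDeltaLoc (lev L k) M a (fun y : Tor M => y ∉ boxBlocks M lo len))⁻¹‖ ≤ Cl * θ ^ k) (k : ℕ) :
    ‖(regionDeltaA (lev L (k + 1)) M a a' (fun y : Tor M => y ∉ boxBlocks M lo len))⁻¹
          * JpR L M (starP L M (fun y : Tor M => y ∉ boxBlocks M lo len)) k
        - JpR L M (starP L M (fun y : Tor M => y ∉ boxBlocks M lo len)) k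
          * (regionDeltaA (lev L k) M a a' (fun y : Tor M => y ∉ boxBlocks M lo len))⁻¹‖
      ≤ C1reg d a' (gamStar d a' (holedConst d a a')) Cl CB (CB + (1 - (L : ℝ)⁻¹) * CH)
          (((sigma0 d a') ^ 2)⁻¹ * ((sigma0 d a') ^ 2)⁻¹ * (2 * (gammaPs d a')⁻¹ * (besovConst d a' 6 48 * Real.sqrt (L : ℝ))))
        * θ ^ k :=
  hinjK_of_local_of_cornerMass_monotone_slice L M (fun y : Tor M => y ∉ boxBlocks M lo len) a a' (locallyMonotone_boxHole M lo len)
    hL hd ha' (holedConst_pos (a := a) (a' := a') ha ha') (sliceCoercive_lev_boxHole M lo len a a' L hlen hM2 ha ha') hτ0 hτ hθ hCB hrate hrateB hloc k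

end BoxHole

end Summit.QuantumFields.BalabanUV.T4Continuum.RegionGaugeResolventTowerMonotone

end
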